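import Mathlib.Analysis.SpecialFunctions.Pow.Real
import Mathlib.Analysis.SpecialFunctions.Sqrt
import HarnessLib
import Literature.Barriers.AtomisticToContinuum.EnergyAsymptoticsWithoutCondensationEstimates

/-!
# Near-minimiser variation for the crux `StaticResponseBound` (stmt-AtomisticToContinuum-12057), IV:
# the extraction lemma (pure real analysis)

Helper file (part 3a) for the registered stub `stub_nearMinCosSqMoment` of line `uv-thomson-force-wave` (skeleton v4,
seat c1).  No physics: along the test families of a `δ`-near-minimiser with `δ = s⁴`, write `P(η) = p₀ + 2ηp₁ + η²p₂`
for the excess energy of `(1+ηV)Φ` over `E₀` times its mass, `Q(σ) = p₀ + 2σ(p₂ − G) + σ²q₂` for the `(1+σV²)` family,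
`c(η) = u₁ + 2ηu₂ + η²u₃` for the modulation and `n(η) = 1 + 2ηu₁ + η²u₂` for the mass.  From `p₀ ≤ s⁴`,
`P(−s²), P(s), Q(−s²) ≥ 0` (variational principle), the discriminant at `η = 0` and `η = s`, and the a-priori bounds,
the registered helper `extract_moment_bound` gives `u₂ ≤ √(BG) + √(s·B·R_tot) + s(√B + N₃/2)` with an explicit
`R_tot`. [folklore]
-/

noncomputable section

namespace Summit.AtomisticToContinuum.BoseEinsteinCondensation.Cruxes.StaticResponseBound.UvThomsonForceWave


/-! ## Part 3 — the extraction (pure real analysis) and the registered stub -/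

section Extraction

/-- **The extraction lemma** (pure real analysis behind `stub_nearMinCosSqMoment`).  Along the test families of a
`δ`-near-minimiser with `δ = s⁴`, write `P(η) = p₀ + 2ηp₁ + η²p₂` for the excess energy of `(1+ηV)Φ` over `E₀` times its
mass and `Q(σ) = p₀ + 2σ(p₂ − G) + σ²q₂` for the `(1+σV²)` family; `c(η) = u₁ + 2ηu₂ + η²u₃` is the modulation and
`n(η) = 1 + 2ηu₁ + η²u₂` the mass.  From `0 ≤ p₀ ≤ s⁴`, `P(±s²), P(s), Q(±s²) ≥ 0` (variational principle), the
discriminant at `η = 0` and `η = s`, and the a-priori bounds, the second moment obeys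
`u₂ ≤ √(BG) + √(s·B·R_tot) + s(√B + N₃/2)` with an explicit `R_tot(A₂, A₄, G_b, N₂, B)`. [folklore] -/
theorem extract_moment_bound' {B s p₀ p₁ p₂ q₂ G Gb u₁ u₂ u₃ A₂ A₄ N2 N3 : ℝ} (hB : 0 < B) (hs0 : 0 < s) (hs1 : s ≤ 1)
    (hp0s : p₀ ≤ s ^ 4)
    (hP2 : 0 ≤ p₀ - 2 * s ^ 2 * p₁ + (s ^ 2) ^ 2 * p₂)
    (hP3 : 0 ≤ p₀ + 2 * s * p₁ + s ^ 2 * p₂)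
    (hQ2 : 0 ≤ p₀ - 2 * s ^ 2 * (p₂ - G) + (s ^ 2) ^ 2 * q₂)
    (hD0 : u₁ ^ 2 ≤ 4 * B * p₀)
    (hDs : (u₁ + 2 * s * u₂ + s ^ 2 * u₃) ^ 2 ≤ 4 * B * (1 + 2 * s * u₁ + s ^ 2 * u₂) * (p₀ + 2 * s * p₁ + s ^ 2 * p₂))
    (hA₂ : |p₂| ≤ A₂) (hA₄ : |q₂| ≤ A₄) (hG0 : 0 ≤ G) (hGb : G ≤ Gb) (hu₂0 : 0 ≤ u₂) (hu₂b : u₂ ≤ N2) (hu₃ : |u₃| ≤ N3) :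
    u₂ ≤ Real.sqrt (B * G) +
      Real.sqrt (s * (B * ((4 * Real.sqrt B + N2) * Gb + (3 + A₂ + A₄) * (1 + (4 * Real.sqrt B + N2))))) +
      s * (Real.sqrt B + N3 / 2) := by
  -- names for the composite constants
  set T₂ : ℝ := 4 * Real.sqrt B + N2 with hT₂
  set R : ℝ := 3 + A₂ + A₄ with hR
  have hsB : 0 ≤ Real.sqrt B := Real.sqrt_nonneg B
  have hA₂0 : 0 ≤ A₂ := (abs_nonneg _).trans hA₂
  have hA₄0 : 0 ≤ A₄ := (abs_nonneg _).trans hA₄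
  have hN20 : 0 ≤ N2 := hu₂0.trans hu₂b
  have hN30 : 0 ≤ N3 := (abs_nonneg _).trans hu₃
  have hGb0 : 0 ≤ Gb := hG0.trans hGb
  have hT₂0 : 0 ≤ T₂ := by rw [hT₂]; positivity
  have hR0 : 0 ≤ R := by rw [hR]; positivity
  have hs2 : 0 < s ^ 2 := pow_pos hs0 2
  have hs3 : 0 < s ^ 3 := pow_pos hs0 3
  have hs4 : 0 < s ^ 4 := pow_pos hs0 4
  have hs_21 : s ^ 2 ≤ s := by nlinarith
  have hs_32 : s ^ 3 ≤ s ^ 2 := by nlinarith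
  have hs_43 : s ^ 4 ≤ s ^ 3 := by nlinarith
  have hs22 : (s ^ 2) ^ 2 = s ^ 4 := by ring
  rw [hs22] at hP2 hQ2
  -- |u₁| ≤ 2√B s²
  have hu₁ : |u₁| ≤ 2 * Real.sqrt B * s ^ 2 := by
    refine abs_le_of_sq_le_sq ?_ (by positivity)
    calc u₁ ^ 2 ≤ 4 * B * p₀ := hD0
      _ ≤ 4 * B * s ^ 4 := by nlinarith
      _ = (2 * Real.sqrt B * s ^ 2) ^ 2 := by rw [mul_pow, mul_pow, Real.sq_sqrt hB.le]; ring
  have hu₁lo : -(2 * Real.sqrt B * s ^ 2) ≤ u₁ := (neg_le_neg hu₁).trans (neg_abs_le u₁)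
  have hu₁hi : u₁ ≤ 2 * Real.sqrt B * s ^ 2 := (le_abs_self u₁).trans hu₁
  have hu₃lo : -N3 ≤ u₃ := (neg_le_neg hu₃).trans (neg_abs_le u₃)
  -- first variations are small: `q`-family
  have hq₂a : s ^ 4 * q₂ ≤ s ^ 4 * A₄ := mul_le_mul_of_nonneg_left ((le_abs_self _).trans hA₄) hs4.le
  have hq₂b : s ^ 4 * (-A₄) ≤ s ^ 4 * q₂ :=
    mul_le_mul_of_nonneg_left ((neg_le_neg hA₄).trans (neg_abs_le q₂)) hs4.le
  have hq₁a : 2 * s ^ 2 * (p₂ - G) ≤ s ^ 4 * (1 + A₄) := by linarith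
  -- `p`-family
  have hp₂a : s ^ 4 * p₂ ≤ s ^ 4 * A₂ := mul_le_mul_of_nonneg_left ((le_abs_self _).trans hA₂) hs4.le
  have hp₂b : s ^ 4 * (-A₂) ≤ s ^ 4 * p₂ :=
    mul_le_mul_of_nonneg_left ((neg_le_neg hA₂).trans (neg_abs_le p₂)) hs4.le
  have hp₁a : 2 * s ^ 2 * p₁ ≤ s ^ 4 * (1 + A₂) := by linarith
  have hp₁a' : 2 * s * p₁ ≤ s ^ 3 * (1 + A₂) := by
    refine le_of_mul_le_mul_left ?_ hs0
    have e1 : s * (2 * s * p₁) = 2 * s ^ 2 * p₁ := by ring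
    have e2 : s * (s ^ 3 * (1 + A₂)) = s ^ 4 * (1 + A₂) := by ring
    rw [e1, e2]; exact hp₁a
  -- `P(s) ≤ s²G + s³R`
  have hPs : p₀ + 2 * s * p₁ + s ^ 2 * p₂ ≤ s ^ 2 * G + s ^ 3 * R := by
    have h1 : s ^ 2 * p₂ ≤ s ^ 2 * G + s ^ 4 * (1 + A₄) / 2 := by linarith
    have h2 : s ^ 4 * (1 + A₄) / 2 ≤ s ^ 3 * (1 + A₄) / 2 := by
      apply div_le_div_of_nonneg_right _ (by norm_num : (0:ℝ) ≤ 2)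
      exact mul_le_mul_of_nonneg_right hs_43 (by positivity)
    have h3 : s ^ 4 ≤ s ^ 3 := hs_43
    have h4 : 0 ≤ s ^ 3 * (1 + A₄) := by positivity
    rw [hR]
    linarith only [hp0s, hp₁a', h1, h2, h3, h4]
  -- mass bound `n(s) ≤ 1 + sT₂`
  have hn : 1 + 2 * s * u₁ + s ^ 2 * u₂ ≤ 1 + s * T₂ := by
    have h1 : 2 * s * u₁ ≤ 4 * Real.sqrt B * s := by
      have h4 : 2 * s * u₁ ≤ 2 * s * (2 * Real.sqrt B * s ^ 2) := mul_le_mul_of_nonneg_left hu₁hi (by positivity)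
      have h3 : s ^ 3 ≤ s := hs_32.trans hs_21
      have h5 : 4 * Real.sqrt B * s ^ 3 ≤ 4 * Real.sqrt B * s := mul_le_mul_of_nonneg_left h3 (by positivity)
      have e : 2 * s * (2 * Real.sqrt B * s ^ 2) = 4 * Real.sqrt B * s ^ 3 := by ring
      linarith only [h4, h5, e]
    have h2 : s ^ 2 * u₂ ≤ s * N2 :=
      (mul_le_mul_of_nonneg_left hu₂b hs2.le).trans (mul_le_mul_of_nonneg_right hs_21 hN20)
    rw [hT₂]; linarith only [h1, h2]
  -- the main inequality with its right-hand side made explicit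
  have hZdef : 0 ≤ B * (1 + s * T₂) * (G + s * R) := by positivity
  have hc2 : (u₁ + 2 * s * u₂ + s ^ 2 * u₃) ^ 2 ≤ (2 * s) ^ 2 * (B * (1 + s * T₂) * (G + s * R)) := by
    have step1 : 4 * B * (1 + 2 * s * u₁ + s ^ 2 * u₂) * (p₀ + 2 * s * p₁ + s ^ 2 * p₂) ≤
        4 * B * (1 + s * T₂) * (p₀ + 2 * s * p₁ + s ^ 2 * p₂) :=
      mul_le_mul_of_nonneg_right (mul_le_mul_of_nonneg_left hn (by positivity)) hP3
    have step2 : 4 * B * (1 + s * T₂) * (p₀ + 2 * s * p₁ + s ^ 2 * p₂) ≤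
        4 * B * (1 + s * T₂) * (s ^ 2 * G + s ^ 3 * R) :=
      mul_le_mul_of_nonneg_left hPs (by positivity)
    have e : 4 * B * (1 + s * T₂) * (s ^ 2 * G + s ^ 3 * R) = (2 * s) ^ 2 * (B * (1 + s * T₂) * (G + s * R)) := by ring
    linarith [hDs, step1, step2, e.le, e.ge]
  -- `√Z ≤ √(BG) + √(sBR_tot)`
  have hZle : B * (1 + s * T₂) * (G + s * R) ≤ B * G + s * (B * (T₂ * Gb + R * (1 + T₂))) := by
    have h1 : s * T₂ * R ≤ T₂ * R := by
      calc s * T₂ * R = s * (T₂ * R) := by ring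
        _ ≤ 1 * (T₂ * R) := mul_le_mul_of_nonneg_right hs1 (mul_nonneg hT₂0 hR0)
        _ = T₂ * R := one_mul _
    have h2 : T₂ * G ≤ T₂ * Gb := mul_le_mul_of_nonneg_left hGb hT₂0
    have e : B * (1 + s * T₂) * (G + s * R) = B * G + s * (B * (T₂ * G + R + s * T₂ * R)) := by ring
    rw [e]
    have e2 : R * (1 + T₂) = R + T₂ * R := by ring
    have h3 : T₂ * G + R + s * T₂ * R ≤ T₂ * Gb + R * (1 + T₂) := by linarith only [h1, h2, e2]
    have h4 : B * (T₂ * G + R + s * T₂ * R) ≤ B * (T₂ * Gb + R * (1 + T₂)) := mul_le_mul_of_nonneg_left h3 hB.le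
    have h5 := mul_le_mul_of_nonneg_left h4 hs0.le
    linarith only [h5]
  have hsqrtZ : Real.sqrt (B * (1 + s * T₂) * (G + s * R)) ≤
      Real.sqrt (B * G) + Real.sqrt (s * (B * (T₂ * Gb + R * (1 + T₂)))) :=
    (Real.sqrt_le_sqrt hZle).trans
      (Literature.Barriers.AtomisticToContinuum.BoseGas.LiebLiniger.sqrt_add_le_sqrt_add_sqrt (by positivity) (by positivity))
  -- the lower bound on the modulation
  set m : ℝ := 2 * s * u₂ - 2 * Real.sqrt B * s ^ 2 - s ^ 2 * N3 with hm
  have hcm : m ≤ u₁ + 2 * s * u₂ + s ^ 2 * u₃ := by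
    have h := mul_le_mul_of_nonneg_left hu₃lo hs2.le
    rw [hm]; linarith only [hu₁lo, h]
  have htarget : 0 ≤ Real.sqrt (B * G) + Real.sqrt (s * (B * (T₂ * Gb + R * (1 + T₂)))) := by positivity
  rcases le_or_gt m 0 with hm0 | hm0
  · -- trivial case
    have h1 : 2 * s * u₂ ≤ 2 * s * (s * (Real.sqrt B + N3 / 2)) := by
      have e : 2 * s * (s * (Real.sqrt B + N3 / 2)) = 2 * Real.sqrt B * s ^ 2 + s ^ 2 * N3 := by ring
      rw [e]; rw [hm] at hm0; linarith only [hm0]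
    have h2 : u₂ ≤ s * (Real.sqrt B + N3 / 2) := le_of_mul_le_mul_left h1 (by positivity)
    linarith only [h2, htarget]
  · -- `m² ≤ c² ≤ (2s)² Z`, so `m ≤ 2s √Z`
    have hm2 : m ^ 2 ≤ (2 * s) ^ 2 * (B * (1 + s * T₂) * (G + s * R)) :=
      (pow_le_pow_left₀ hm0.le hcm 2).trans hc2
    have hmle : m ≤ 2 * s * Real.sqrt (B * (1 + s * T₂) * (G + s * R)) := by
      have h1 : Real.sqrt (m ^ 2) ≤ Real.sqrt ((2 * s) ^ 2 * (B * (1 + s * T₂) * (G + s * R))) := Real.sqrt_le_sqrt hm2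
      rw [Real.sqrt_sq hm0.le, Real.sqrt_mul (sq_nonneg _), Real.sqrt_sq (by positivity)] at h1
      exact h1
    have h1 : 2 * s * u₂ ≤ 2 * s * (Real.sqrt (B * (1 + s * T₂) * (G + s * R)) + s * (Real.sqrt B + N3 / 2)) := by
      have e : 2 * s * (Real.sqrt (B * (1 + s * T₂) * (G + s * R)) + s * (Real.sqrt B + N3 / 2)) =
          2 * s * Real.sqrt (B * (1 + s * T₂) * (G + s * R)) + 2 * Real.sqrt B * s ^ 2 + s ^ 2 * N3 := by ring
      rw [e]; rw [hm] at hmle; linarith only [hmle]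
    have h2 : u₂ ≤ Real.sqrt (B * (1 + s * T₂) * (G + s * R)) + s * (Real.sqrt B + N3 / 2) :=
      le_of_mul_le_mul_left h1 (by positivity)
    linarith only [h2, hsqrtZ]

/-- **The extraction lemma** (registered helper form `extract_moment_bound`, sub-goal of the stub `stub_nearMinCosSqMoment`):
verbatim `extract_moment_bound'` with all binders explicit. [folklore] -/
theorem extract_moment_bound : ∀ {B s p₀ p₁ p₂ q₂ G Gb u₁ u₂ u₃ A₂ A₄ N2 N3 : ℝ}, 0 < B → 0 < s → s ≤ 1 →
    p₀ ≤ s ^ 4 →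
    0 ≤ p₀ - 2 * s ^ 2 * p₁ + (s ^ 2) ^ 2 * p₂ →
    0 ≤ p₀ + 2 * s * p₁ + s ^ 2 * p₂ →
    0 ≤ p₀ - 2 * s ^ 2 * (p₂ - G) + (s ^ 2) ^ 2 * q₂ →
    u₁ ^ 2 ≤ 4 * B * p₀ →
    (u₁ + 2 * s * u₂ + s ^ 2 * u₃) ^ 2 ≤ 4 * B * (1 + 2 * s * u₁ + s ^ 2 * u₂) * (p₀ + 2 * s * p₁ + s ^ 2 * p₂) →
    |p₂| ≤ A₂ → |q₂| ≤ A₄ → 0 ≤ G → G ≤ Gb → 0 ≤ u₂ → u₂ ≤ N2 → |u₃| ≤ N3 →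
    u₂ ≤ Real.sqrt (B * G) +
      Real.sqrt (s * (B * ((4 * Real.sqrt B + N2) * Gb + (3 + A₂ + A₄) * (1 + (4 * Real.sqrt B + N2))))) +
      s * (Real.sqrt B + N3 / 2) :=
  fun hB hs0 hs1 hp0s hP2 hP3 hQ2 hD0 hDs hA₂ hA₄ hG0 hGb hu₂0 hu₂b hu₃ =>
    extract_moment_bound' hB hs0 hs1 hp0s hP2 hP3 hQ2 hD0 hDs hA₂ hA₄ hG0 hGb hu₂0 hu₂b hu₃

end Extraction
end Summit.AtomisticToContinuum.BoseEinsteinCondensation.Cruxes.StaticResponseBound.UvThomsonForceWave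

end
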